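import Summits.Ventures.PercRepro.CoreCountWrapper
import Summits.Ventures.PercRepro.RankLevelSetM
import Summits.Ventures.PercRepro.RankLevelSetCorankFour

/-!
# PercRepro — for `p ≥ 170` the core of the wrapper satisfies C-025 at `(p, 3)` at EVERY corank (p2, gen 11)

On the core of `ThmN.rls_succ_all` (simple, every element with an `e`-free partition, rank `p`), C-025 at `(p, 3)` is
known in the kernel cell by cell: corank `≤ 2` (no set has rank `p` with a rank-`3` complement), corank `3` (Theorem M,
`c025_of_ncard_eq`), corank `4` for `|E| ≥ 100` (night-1's `c025_corank_four_simple`), corank `5` for `p ≥ 201`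
(`c025_core_of_regime_five`) and for `170 ≤ p ≤ 200` (the 31 cells `(p, 5)` by `decide +kernel` — regime A holds at `d = 5`
exactly from `p = 170` on), and corank `≥ amin p` (`c025_core_sparse_amin`). For `p ≥ 170` that is every corank.

* `rls_three_of_ncard_le` — corank `≤ 2`; `three_le_encard_circuit` — a simple matroid of rank `≥ 2` has no circuit with
  `≤ 2` elements (the hypothesis shape of `c025_corank_four_simple`);
* `table_five`, `regime_five_of_le` — regime A at `d = 5` for `170 ≤ p ≤ 200` (cells) and `p ≥ 201` (`CoreRegimesFive`);
* **`c025_core_large`** — `170 ≤ p` ⇒ `ThmN.RLS M p 3` on the core, at every corank;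
* `SmallCoreCells''` — the core statement on the FINITE family of cells `p ∈ {7, 8}` or `9 ≤ p ≤ 169`,
  `p + 4 ≤ |E| < p + amin p`, corank `4` only below `|E| = 100` (corank `≤ 2` is empty, `3` is Theorem M, `4` at `|E| ≥ 100` is d76);
  `smallCoreCells'_of`, **`c025_three_of_smallCoreCells''`** — C-025 at `q = 3` on every finite matroid from those cells.
Imports `CoreCountWrapper`, `RankLevelSetM`, `RankLevelSetCorankFour`. Axioms: standard.
-/

namespace PercRepro
namespace CoreCount

variable {α : Type}

/-- **Corank `≤ 2`**: no subset has rank `p` with a complement of rank `3`, so `U(p,3) = ∅`. -/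
theorem rls_three_of_ncard_le (M : Matroid α) [M.Finite] (p : ℕ) (hE : M.E.ncard ≤ p + 2) : ThmN.RLS M p 3 := by
  unfold ThmN.RLS
  have hU : {A : Set α | A ⊆ M.E ∧ M.eRk A = (p : ℕ∞) ∧ M.eRk (M.E \ A) = ((3 : ℕ) : ℕ∞)} = ∅ := by
    ext A
    simp only [Set.mem_setOf_eq, Set.mem_empty_iff_false, iff_false, not_and]
    intro hA hr hr'
    have h1 : (p : ℕ∞) ≤ A.encard := by rw [← hr]; exact M.eRk_le_encard A
    have h2 : ((3 : ℕ) : ℕ∞) ≤ (M.E \ A).encard := by rw [← hr']; exact M.eRk_le_encard _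
    have h3 : (M.E \ A).encard + A.encard = M.E.encard := Set.encard_sdiff_add_encard_of_subset hA
    have hAfin : A.Finite := M.ground_finite.subset hA
    have hBfin : (M.E \ A).Finite := M.ground_finite.subset Set.sdiff_subset
    rw [← hAfin.cast_ncard_eq] at h1 h3
    rw [← hBfin.cast_ncard_eq] at h2 h3
    rw [← M.ground_finite.cast_ncard_eq] at h3
    have h1' : p ≤ A.ncard := by exact_mod_cast h1
    have h2' : 3 ≤ (M.E \ A).ncard := by exact_mod_cast h2
    have h3' : (M.E \ A).ncard + A.ncard = M.E.ncard := by exact_mod_cast h3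
    omega
  rw [hU, Set.ncard_empty]
  simp only [Nat.cast_zero, mul_zero]
  positivity

/-- A simple matroid (pairs of rank `2`) of rank `≥ 2` has no circuit with `≤ 2` elements. -/
theorem three_le_encard_circuit (M : Matroid α) [M.Finite]
    (hs : ∀ e ∈ M.E, ∀ f ∈ M.E, e ≠ f → M.eRk {e, f} = 2) (hrank : 2 ≤ M.eRank)
    {C : Set α} (hC : M.IsCircuit C) : 3 ≤ C.encard := by
  by_contra hlt
  push Not at hlt
  have hCE : C ⊆ M.E := hC.subset_ground
  have hCfin : C.Finite := M.ground_finite.subset hCE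
  have hr := hC.eRk_add_one_eq
  rw [← hCfin.cast_ncard_eq] at hlt hr
  have hlt' : C.ncard < 3 := by exact_mod_cast hlt
  have hpos : 0 < C.ncard := (Set.ncard_pos hCfin).2 hC.nonempty
  rcases (show C.ncard = 1 ∨ C.ncard = 2 by omega) with h1 | h2
  · -- a loop `x`: `r{x} = 0`, yet some `f ≠ x` has `r{x, f} = 2`
    obtain ⟨x, rfl⟩ := Set.ncard_eq_one.1 h1
    rw [h1] at hr
    have hx0 : M.eRk {x} = 0 := by
      have h' : M.eRk {x} + 1 = 0 + 1 := by rw [zero_add]; exact_mod_cast hr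
      exact WithTop.add_right_cancel (by norm_num : (1 : ℕ∞) ≠ ⊤) h'
    have hxE : x ∈ M.E := hCE (Set.mem_singleton x)
    -- `E ⊄ {x}` since `r(E) ≥ 2 > 0 = r{x}`
    have hex : ∃ f ∈ M.E, f ≠ x := by
      by_contra hall
      push Not at hall
      have hsub : M.E ⊆ {x} := fun f hf => by rw [Set.mem_singleton_iff]; exact hall f hf
      have : M.eRank ≤ M.eRk {x} := by rw [M.eRank_def]; exact M.eRk_mono hsub
      rw [hx0] at this
      have : (2 : ℕ∞) ≤ 0 := hrank.trans this
      norm_num at this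
    obtain ⟨f, hf, hfx⟩ := hex
    have h2 := hs x hxE f hf (Ne.symm hfx)
    have hle : M.eRk {x, f} ≤ M.eRk {x} + M.eRk {f} := by
      rw [Set.insert_eq]
      exact M.eRk_union_le_eRk_add_eRk _ _
    have hf1 : M.eRk {f} ≤ 1 := by
      have := M.eRk_le_encard {f}
      rwa [Set.encard_singleton] at this
    rw [h2, hx0, zero_add] at hle
    have : (2 : ℕ∞) ≤ 1 := hle.trans hf1
    norm_num at this
  · -- a two-element circuit `{x, y}` has rank `1`, against `r{x, y} = 2`
    obtain ⟨x, y, hxy, rfl⟩ := Set.ncard_eq_two.1 h2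
    rw [h2] at hr
    have hxE : x ∈ M.E := hCE (by simp)
    have hyE : y ∈ M.E := hCE (by simp)
    have h2' := hs x hxE y hyE hxy
    rw [h2'] at hr
    have : (2 : ℕ∞) + 1 = ((2 : ℕ) : ℕ∞) := hr
    norm_num at this

/-- The cells `(p, 5)` for `170 ≤ p ≤ 200`, by kernel evaluation (regime A holds at `d = 5` exactly from `p = 170`). -/
theorem table_five : ∀ p < 201, 170 ≤ p → CoreRegimes.cellOK p 5 = true := by
  decide +kernel

/-- Regime A or B′ at `d = 5` for every `p ≥ 170`. -/
theorem regime_five_of_le (p : ℕ) (hp : 170 ≤ p) : CoreRegimes.RegimeA p 5 ∨ CoreRegimes.RegimeB p 5 := by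
  rcases Nat.lt_or_ge p 201 with h | h
  · exact Or.inl (CoreRegimes.regimeA_of_cellOK p 5 (by omega) (table_five p h hp))
  · exact CoreRegimes.regime_of_five_le p 5 h (le_refl _)

/-- **For `p ≥ 170` the core of the wrapper satisfies C-025 at `(p, 3)` at every corank.** -/
theorem c025_core_large (M : Matroid α) [M.Finite] (p : ℕ) (hp : 170 ≤ p)
    (hs : ∀ e ∈ M.E, ∀ f ∈ M.E, e ≠ f → M.eRk {e, f} = 2)
    (hfree : ∀ e ∈ M.E, ∃ A ⊆ M.E \ {e}, e ∉ M.closure A ∧ e ∉ M.closure ((M.E \ {e}) \ A))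
    (hrank : M.eRank = (p : ℕ∞)) : ThmN.RLS M p 3 := by
  have hpE : p ≤ M.E.ncard := by
    have h := M.eRank_le_encard_ground
    rw [hrank, ← M.ground_finite.cast_ncard_eq] at h
    exact_mod_cast h
  have hC1 : ∀ L ⊆ M.E, M.eRk L = 2 → L.ncard ≤ 3 :=
    fun L hL hr => ThmN.ncard_le_three_of_eRk_two M hs hfree hL hr
  have hC2 : ∀ P ⊆ M.E, M.eRk P = 3 → P.ncard ≤ 7 :=
    fun P hP hr => ThmN.ncard_le_seven_of_eRk_three M hs hfree hP hr
  rcases Nat.lt_or_ge (p + 2) M.E.ncard with h2 | h2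
  swap
  · exact rls_three_of_ncard_le M p h2
  rcases eq_or_ne M.E.ncard (p + 3) with h3 | h3
  · exact c025_of_ncard_eq M p 3 h3
  rcases eq_or_ne M.E.ncard (p + 4) with h4 | h4
  · have hd : M.E.encard = M.eRank + 4 := by
      rw [hrank, ← M.ground_finite.cast_ncard_eq, h4]; push_cast; rfl
    have hcirc : ∀ C, M.IsCircuit C → 3 ≤ C.encard := fun C hC =>
      three_le_encard_circuit M hs (by rw [hrank]; exact_mod_cast (show 2 ≤ p by omega)) hC
    have h := c025_corank_four_simple M p (by omega) hd hrank hcirc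
    unfold Matroid.topCount Matroid.midCount at h
    exact h
  rcases eq_or_ne M.E.ncard (p + 5) with h5 | h5
  · exact c025_core_of_regime_aux M p 5 (regime_five_of_le p hp) hs hC1 hC2 hrank h5
  · have hd6 : 6 ≤ M.E.ncard - p := by omega
    exact c025_core_of_regime_aux M p (M.E.ncard - p)
      (CoreRegimes.regime_of_amin p (M.E.ncard - p) (by omega) (by unfold CoreRegimes.amin; simp [show ¬ p ≤ 9 by omega, show ¬ p ≤ 12 by omega]; exact hd6))
      hs hC1 hC2 hrank (by omega)

/-- **The small cells, bounded in `p` and in corank from below**: `p ∈ {7, 8}`, or `9 ≤ p ≤ 169` with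
`p + 4 ≤ |E| < p + amin p` (corank `4` or `5` for `13 ≤ p ≤ 169`, `4`–`6` for `10 ≤ p ≤ 12`, `4`–`7` for `p = 9`),
the corank-`4` cells only below `|E| = 100` — a finite family of `(p, corank)` cells. -/
def SmallCoreCells'' : Prop :=
  ∀ {α : Type} (M : Matroid α) [M.Finite] (p : ℕ), 5 ≤ p →
    (∀ e ∈ M.E, ∀ f ∈ M.E, e ≠ f → M.eRk {e, f} = 2) → M.eRank = (p : ℕ∞) →
    (∀ e, ¬ M.IsColoop e) →
    (∀ e ∈ M.E, ∃ A ⊆ M.E \ {e}, e ∉ M.closure A ∧ e ∉ M.closure ((M.E \ {e}) \ A)) →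
    ((p = 7 ∨ p = 8) ∨
      (p ≤ 169 ∧ p + 4 ≤ M.E.ncard ∧ M.E.ncard < p + CoreRegimes.amin p ∧ ¬ (M.E.ncard = p + 4 ∧ 100 ≤ M.E.ncard))) →
    ThmN.RLS M p 3

/-- The cells outside `SmallCoreCells''` are kernel: `p ≥ 170` (`c025_core_large`), corank `≤ 2`, corank `3`
(Theorem M), corank `4` at `|E| ≥ 100` (night-1's `c025_corank_four_simple`). -/
theorem smallCoreCells'_of (h : SmallCoreCells'') : SmallCoreCells' := by
  intro α M _ p hp hs hrank hcoloop hfree hcell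
  rcases hcell with h78 | hlt
  · exact h M p hp hs hrank hcoloop hfree (Or.inl h78)
  · rcases Nat.lt_or_ge p 170 with hp169 | hp170
    swap
    · exact c025_core_large M p hp170 hs hfree hrank
    rcases Nat.lt_or_ge M.E.ncard (p + 3) with hle | hge
    · exact rls_three_of_ncard_le M p (by omega)
    rcases eq_or_ne M.E.ncard (p + 3) with h3 | h3
    · exact c025_of_ncard_eq M p 3 h3
    by_cases h4 : M.E.ncard = p + 4 ∧ 100 ≤ M.E.ncard
    · have hd : M.E.encard = M.eRank + 4 := by
        rw [hrank, ← M.ground_finite.cast_ncard_eq, h4.1]; push_cast; rfl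
      have hcirc : ∀ C, M.IsCircuit C → 3 ≤ C.encard := fun C hC =>
        three_le_encard_circuit M hs (by rw [hrank]; exact_mod_cast (show 2 ≤ p by omega)) hC
      have h := c025_corank_four_simple M p h4.2 hd hrank hcirc
      unfold Matroid.topCount Matroid.midCount at h
      exact h
    · exact h M p hp hs hrank hcoloop hfree (Or.inr ⟨by omega, by omega, hlt, h4⟩)

/-- **C-025 at `q = 3` for every finite matroid and every `p ≥ 5`, from the finite family of small core cells.** -/
theorem c025_three_of_smallCoreCells'' (h : SmallCoreCells'') :
    ∀ {α : Type} (M : Matroid α) [M.Finite] (p : ℕ), 5 ≤ p → ThmN.RLS M p 3 :=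
  c025_three_of_smallCoreCells' (smallCoreCells'_of h)

end CoreCount
end PercRepro
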